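import Mathlib
import Summits.NavierStokesRegularity.NavierStokesRegularity.Theses.LevelSetModeration
import Summits.NavierStokesRegularity.NavierStokesRegularity.Theorems.LevelSetModerationHighSpeedPressureWorkConsequences
import Summits.NavierStokesRegularity.NavierStokesRegularity.Theorems.LevelSetModerationLevelSetEnergyInequality

/-!
# Route LevelSetModeration — crux `HighSpeedPressureWork` implies the linear level-set law (L1)

The load-bearing stub `stub_linearLevelSetLaw` (L1) of line `linear_closure` (item
stmt-NavierStokesRegularity-18149) is a CONSEQUENCE of the crux: with the proved route item
`LevelSetEnergyInequality` (`levelSetModeration_levelSetEnergyInequality_proof`) the landed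
`highSpeedPressureWork_speedGradientLaw` gives `ν² D_c(T) ≤ max(F M^m V_c(T), 0)` and
`∫(|u(t)|−c)₊² + 2ν D_c(T) ≤ 4 max(F M^m V_c(T), 0)/ν`; with the nonnegative modulus
`Λ := max(F, 0)` this is L1 verbatim (same exponent `m`). Together with the landed transfer
`levelSetModeration_highSpeedPressureWork_of_linearLaw_of_bookkeeping` (L1 ∧ L3 → crux): modulo the
bounded bookkeeping L3, the crux and the linear law are EQUIVALENT.
-/

noncomputable section

-- single-conjunct summit: `Summit.<Summit>.<Problem>` repeats the name by the D-0017 layout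
set_option linter.dupNamespace false

namespace Summit.NavierStokesRegularity.NavierStokesRegularity.Theorems

open MeasureTheory Set Filter Topology
open scoped ENNReal
open Literature.Analysis.FluidPDE
open Summit.NavierStokesRegularity.NavierStokesRegularity.Theses.LevelSetModeration

/-- **The crux implies the linear level-set law** (stub L1 of line `linear_closure`, verbatim, from
`HighSpeedPressureWork`): modulus `Λ := max(F, 0)`, same exponent `m < 10/3`
(`highSpeedPressureWork_speedGradientLaw` with the proved `LevelSetEnergyInequality`). -/
theorem levelSetModeration_linearLevelSetLaw_of_highSpeedPressureWork :
    Summit.NavierStokesRegularity.NavierStokesRegularity.Theses.LevelSetModeration.HighSpeedPressureWork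
      → (∀ (ν T : ℝ), 0 < ν → 0 < T → ∃ m : ℝ, m < 10 / 3 ∧ ∃ Λ : ℝ → ℝ → ℝ, ∀ (u : ℝ →
      EuclideanSpace ℝ (Fin 3) → EuclideanSpace ℝ (Fin 3)) (p : ℝ → EuclideanSpace ℝ (Fin 3) → ℝ),
      Literature.Analysis.FluidPDE.IsClassicalNSSolutionOn (Set.Ico 0 T) ν 0 u p →
      Literature.Analysis.FluidPDE.IsLerayHopfOn T ν 0 (u 0) u →
      Literature.Analysis.FluidPDE.HasRapidSpatialDecay (u 0) → ∀ (E₀ B₀ : ℝ), (∫ x, ‖u 0 x‖ ^ 2) ≤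
      E₀ → (∀ x, ‖u 0 x‖ ≤ B₀) → ∀ (M c : ℝ), 2 * B₀ ≤ M → M / 2 ≤ c → c ≤ M → 0 < c → ν ^ 2 * (∫⁻
      τ in Set.Ioo 0 T, ∫⁻ x, Set.indicator {x | c < ‖u τ x‖} (fun x => ENNReal.ofReal (‖fderiv ℝ
      (fun y => ‖u τ y‖) x‖ ^ 2)) x).toReal ≤ Λ E₀ B₀ * M ^ m * (∫⁻ τ in Set.Ioo 0 T,
      MeasureTheory.volume {x | c < ‖u τ x‖}).toReal ∧ ∀ t ∈ Set.Ico 0 T, (∫ x, (max (‖u t x‖ - c)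
      0) ^ 2) ≤ 4 * (Λ E₀ B₀ * M ^ m * (∫⁻ τ in Set.Ioo 0 T, MeasureTheory.volume {x | c < ‖u τ
      x‖}).toReal) / ν) := by
  intro hH ν T hν hT
  obtain ⟨m, hm, F, hF⟩ :=
    highSpeedPressureWork_speedGradientLaw hH levelSetModeration_levelSetEnergyInequality_proof ν T hν hT
  refine ⟨m, hm, fun E₀ B₀ => max (F E₀ B₀) 0, ?_⟩
  intro u p hcl hLH hdec E₀ B₀ hE hB M c hM hMc hcM hc
  obtain ⟨h1, h2⟩ := hF u p hcl hLH hdec E₀ B₀ hE hB M c hM hMc hcM hc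
  have hM0 : 0 ≤ M := hc.le.trans hcM
  have hV0 : 0 ≤ (∫⁻ τ in Set.Ioo 0 T, volume {x | c < ‖u τ x‖}).toReal := ENNReal.toReal_nonneg
  have hmax : max (F E₀ B₀ * M ^ m * (∫⁻ τ in Set.Ioo 0 T, volume {x | c < ‖u τ x‖}).toReal) 0 ≤
      max (F E₀ B₀) 0 * M ^ m * (∫⁻ τ in Set.Ioo 0 T, volume {x | c < ‖u τ x‖}).toReal :=
    max_le (mul_le_mul_of_nonneg_right (mul_le_mul_of_nonneg_right (le_max_left _ _)
      (Real.rpow_nonneg hM0 m)) hV0) (by positivity)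
  refine ⟨h1.trans hmax, fun t ht => ?_⟩
  have h3 := h2 t ht
  have hD0 : 0 ≤ 2 * ν * (∫⁻ τ in Set.Ioo 0 T, ∫⁻ x, Set.indicator {x | c < ‖u τ x‖}
      (fun x => ENNReal.ofReal (‖fderiv ℝ (fun y => ‖u τ y‖) x‖ ^ 2)) x).toReal := by positivity
  have h4 : 4 * max (F E₀ B₀ * M ^ m * (∫⁻ τ in Set.Ioo 0 T, volume {x | c < ‖u τ x‖}).toReal) 0
      / ν ≤ 4 * (max (F E₀ B₀) 0 * M ^ m *
        (∫⁻ τ in Set.Ioo 0 T, volume {x | c < ‖u τ x‖}).toReal) / ν := by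
    gcongr
  linarith

end Summit.NavierStokesRegularity.NavierStokesRegularity.Theorems

end
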